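import Literature.Computability.Complexity.StackArith
import HarnessLib

/-!
# Verified arithmetic on stack programs: modular multiplication and exponentiation

Trunk `CplxCore`, toolkit continuing `StackArith.lean` (structured stack programs `Com` with
proved functional models and step bounds; the arithmetic register bank `AReg` with `add`,
`sub`, `normalize`). Using only addition, conditional subtraction and normalisation of that
file we program and verify, on the bank,

* `Com.modDbl` — `x := 2x mod y` (`runs_modDbl`, model `modDblRes`, `bitsToNat_modDblRes`);
* `Com.swapYZ`, `Com.modAddZ` — `x := (x + z) mod y` (`runs_modAddZ`, `bitsToNat_modAddRes`);
* `Com.modMulStep b` — the Horner step `x := (2x + b·z) mod y` (`runs_modMulStep`);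

and, for programs over a larger register file `κ ⊕ AReg` (bank programs embedded by
`Com.map Sum.inr`, `Com.bk`; `StackPrograms.lean`, `Runs.inr`), with operands in outer
registers `κ`:

* `Com.modMul m` — **modular multiplication by double-and-add** over the bits of the outer
  register `m` (multiplier, most significant bit first): from `x = 0`, `x := z · m mod y`
  (`runs_modMul`, model `modMulRes`, `bitsToNat_modMulRes`);
* `Com.modExp e xb m` — **modular exponentiation by repeated squaring** (CLRS,
  MODULAR-EXPONENTIATION, left to right) over the bits of the outer register `e`: from `x = 1`,
  `x := xb ^ e mod y` (`runs_modExp`, model `modExpRes`, `bitsToNat_modExpRes`), within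
  `|e| · (modExpStepCost |y| + 2) + 1` steps, `modExpStepCost L = 382 L² + 262 L + 13`.

All results are kept reduced and normalised, hence never longer than the modulus
(`modMulRes_lt_and_length`, `modExpRes_lt_and_length`), which is what makes the step bounds
polynomial. Served: the order-candidate test `x ^ c ≡ 1 (mod n)` of the post-processor of
Shor's order finding (`ShorAssembly.lean`, `ordPost_mem_FP`); reusable by any `FP`-membership
proof needing modular arithmetic (e.g. discrete exponentiation).

## References

* T. H. Cormen, C. E. Leiserson, R. L. Rivest, C. Stein, *Introduction to Algorithms*, MIT Press
  (3rd ed. 2009), §31.6, procedure MODULAR-EXPONENTIATION and its loop invariant (text checked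
  in the held 2nd edition, `book:cormennd-introduction-algorithms`, pp. 673–674 of the file).
* D. E. Knuth, *The Art of Computer Programming*, Vol. 2, 3rd ed., Addison-Wesley 1998, §4.3.1
  (classical addition/subtraction) and §4.6.3 (binary method of exponentiation). (Not held.)
* T. Nipkow, G. Klein, *Concrete Semantics with Isabelle/HOL*, Springer 2014, Ch. 7 (big-step
  reasoning), for the verification style.
-/

namespace Literature.Computability.Complexity

open _root_.Computability AReg

/-- A normal form of a value below `bitsToNat n` is not longer than `n`. [folklore] -/
theorem length_norm_le_of_lt {v n : List Bool} (h : bitsToNat v < bitsToNat n) :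
    (norm v).length ≤ n.length := by
  rw [length_norm, Nat.size_le]
  exact h.trans (bitsToNat_lt n)

namespace Com

/-! ### Modular doubling -/

/-- `modDbl`: on the bank, `x := 2x mod y` for `x < y`: push a low zero, conditionally subtract
`y`, drop the comparison flag, normalise. [folklore] -/
def modDbl : Com AReg := push .x false ;; sub ;; clear .g ;; normalize

/-- Raw model of `modDbl` (before normalisation). [folklore] -/
def modDblRaw (acc n : List Bool) : List Bool :=
  bif subBorrow (false :: acc) n then false :: acc else subRes (false :: acc) n

/-- Model of `modDbl`. [folklore] -/
def modDblRes (acc n : List Bool) : List Bool := norm (modDblRaw acc n)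

/-- Value of the raw model. [folklore] -/
theorem bitsToNat_modDblRaw (acc n : List Bool) (h : bitsToNat acc < bitsToNat n) :
    bitsToNat (modDblRaw acc n) = (2 * bitsToNat acc) % bitsToNat n := by
  unfold modDblRaw
  have h2 : bitsToNat (false :: acc) = 2 * bitsToNat acc := by simp
  rw [subBorrow_iff, h2]
  by_cases hlt : 2 * bitsToNat acc < bitsToNat n
  · simp [hlt, Nat.mod_eq_of_lt hlt]
  · have hle : bitsToNat n ≤ 2 * bitsToNat acc := Nat.le_of_not_lt hlt
    simp only [hlt, decide_false, cond_false]
    rw [bitsToNat_subRes _ _ (by rw [h2]; exact hle), h2, Nat.mod_eq_sub_mod hle,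
      Nat.mod_eq_of_lt (by omega)]

/-- Length of the raw model. [folklore] -/
theorem length_modDblRaw (acc n : List Bool) : (modDblRaw acc n).length = acc.length + 1 := by
  unfold modDblRaw
  cases subBorrow (false :: acc) n <;> simp [length_subRes]

/-- **Value of `modDbl`.** [folklore] -/
theorem bitsToNat_modDblRes (acc n : List Bool) (h : bitsToNat acc < bitsToNat n) :
    bitsToNat (modDblRes acc n) = (2 * bitsToNat acc) % bitsToNat n := by
  rw [modDblRes, bitsToNat_norm, bitsToNat_modDblRaw acc n h]

/-- The result of `modDbl` is reduced. [folklore] -/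
theorem bitsToNat_modDblRes_lt (acc n : List Bool) (h : bitsToNat acc < bitsToNat n) :
    bitsToNat (modDblRes acc n) < bitsToNat n := by
  rw [bitsToNat_modDblRes acc n h]; exact Nat.mod_lt _ (by omega)

/-- The result of `modDbl` is not longer than the modulus. [folklore] -/
theorem length_modDblRes_le (acc n : List Bool) (h : bitsToNat acc < bitsToNat n) :
    (modDblRes acc n).length ≤ n.length :=
  length_norm_le_of_lt (by rw [bitsToNat_modDblRaw acc n h]; exact Nat.mod_lt _ (by omega))

/-- **Simulation of `modDbl`**, in `25|x| + 16|y| + 46` steps. [folklore] -/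
theorem runs_modDbl (acc n z : List Bool) :
    Runs modDbl (file acc n z [] [] [] [] []) (file (modDblRes acc n) n z [] [] [] [] [])
      (25 * acc.length + 16 * n.length + 46) := by
  have h1 : Runs (push .x false) (file acc n z [] [] [] [] []) (file (false :: acc) n z [] [] [] [] []) 1 :=
    Runs.push' (by simp)
  have h2 := runs_sub (false :: acc) n z
  have h3 : Runs (clear .g) (file (modDblRaw acc n) n z [] [] [] [] (flag !subBorrow (false :: acc) n))
      (file (modDblRaw acc n) n z [] [] [] [] []) 3 :=
    (runs_clear AReg.g _).of_eq (by simp) (by cases subBorrow (false :: acc) n <;> simp)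
  have h4 := runs_normalize (modDblRaw acc n) n z [] [] []
  refine (h1.seq (h2.seq (h3.seq h4))).of_eq rfl ?_
  rw [length_modDblRaw, List.length_cons]; omega

/-! ### Exchanging the second and third operand -/

/-- `swapYZ`: exchange `y` and `z` (through the empty scratch `s t`). [folklore] -/
def swapYZ : Com AReg := pour .y .s ;; pour .z .t ;; pour .s .z ;; pour .t .y

/-- **Simulation of `swapYZ`**, in `6(|y| + |z|) + 4` steps. [folklore] -/
theorem runs_swapYZ (x y z u f g : List Bool) :
    Runs swapYZ (file x y z [] [] u f g) (file x z y [] [] u f g) (6 * (y.length + z.length) + 4) := by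
  have h1 : Runs (pour .y .s) (file x y z [] [] u f g) (file x [] z y.reverse [] u f g) (3 * y.length + 1) :=
    (runs_pour (a := AReg.y) (b := AReg.s) (by decide) _).of_eq (by simp) (by simp)
  have h2 : Runs (pour .z .t) (file x [] z y.reverse [] u f g) (file x [] [] y.reverse z.reverse u f g)
      (3 * z.length + 1) :=
    (runs_pour (a := AReg.z) (b := AReg.t) (by decide) _).of_eq (by simp) (by simp)
  have h3 : Runs (pour .s .z) (file x [] [] y.reverse z.reverse u f g) (file x [] y [] z.reverse u f g)
      (3 * y.length + 1) :=
    (runs_pour (a := AReg.s) (b := AReg.z) (by decide) _).of_eq (by simp) (by simp)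
  have h4 : Runs (pour .t .y) (file x [] y [] z.reverse u f g) (file x z y [] [] u f g)
      (3 * z.length + 1) :=
    (runs_pour (a := AReg.t) (b := AReg.y) (by decide) _).of_eq (by simp) (by simp)
  exact (h1.seq (h2.seq (h3.seq h4))).of_eq rfl (by omega)

/-! ### Modular addition of the third operand -/

/-- `modAddZ`: on the bank, `x := (x + z) mod y` for `x, z < y`. [folklore] -/
def modAddZ : Com AReg := swapYZ ;; add ;; swapYZ ;; sub ;; clear .g ;; normalize

/-- Raw model of `modAddZ`. [folklore] -/
def modAddRaw (acc xx n : List Bool) : List Bool :=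
  bif subBorrow (addRes acc xx) n then addRes acc xx else subRes (addRes acc xx) n

/-- Model of `modAddZ`. [folklore] -/
def modAddRes (acc xx n : List Bool) : List Bool := norm (modAddRaw acc xx n)

/-- Value of the raw model. [folklore] -/
theorem bitsToNat_modAddRaw (acc xx n : List Bool) (h : bitsToNat acc < bitsToNat n)
    (hx : bitsToNat xx < bitsToNat n) :
    bitsToNat (modAddRaw acc xx n) = (bitsToNat acc + bitsToNat xx) % bitsToNat n := by
  unfold modAddRaw
  rw [subBorrow_iff, bitsToNat_addRes]
  by_cases hlt : bitsToNat acc + bitsToNat xx < bitsToNat n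
  · simp [hlt, Nat.mod_eq_of_lt hlt, bitsToNat_addRes]
  · have hle : bitsToNat n ≤ bitsToNat acc + bitsToNat xx := Nat.le_of_not_lt hlt
    simp only [hlt, decide_false, cond_false]
    rw [bitsToNat_subRes _ _ (by rw [bitsToNat_addRes]; exact hle), bitsToNat_addRes,
      Nat.mod_eq_sub_mod hle, Nat.mod_eq_of_lt (by omega)]

/-- Length of the raw model. [folklore] -/
theorem length_modAddRaw (acc xx n : List Bool) :
    (modAddRaw acc xx n).length = (addRes acc xx).length := by
  unfold modAddRaw
  cases subBorrow (addRes acc xx) n <;> simp [length_subRes]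

/-- **Value of `modAddZ`.** [folklore] -/
theorem bitsToNat_modAddRes (acc xx n : List Bool) (h : bitsToNat acc < bitsToNat n)
    (hx : bitsToNat xx < bitsToNat n) :
    bitsToNat (modAddRes acc xx n) = (bitsToNat acc + bitsToNat xx) % bitsToNat n := by
  rw [modAddRes, bitsToNat_norm, bitsToNat_modAddRaw acc xx n h hx]

/-- The result of `modAddZ` is not longer than the modulus. [folklore] -/
theorem length_modAddRes_le (acc xx n : List Bool) (h : bitsToNat acc < bitsToNat n)
    (hx : bitsToNat xx < bitsToNat n) : (modAddRes acc xx n).length ≤ n.length :=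
  length_norm_le_of_lt (by rw [bitsToNat_modAddRaw acc xx n h hx]; exact Nat.mod_lt _ (by omega))

/-- **Simulation of `modAddZ`**, in `50(|x| + |y| + |z|) + 65` steps. [folklore] -/
theorem runs_modAddZ (acc n xx : List Bool) :
    Runs modAddZ (file acc n xx [] [] [] [] []) (file (modAddRes acc xx n) n xx [] [] [] [] [])
      (50 * (acc.length + n.length + xx.length) + 65) := by
  have h1 := runs_swapYZ acc n xx [] [] []
  have h2 := runs_add acc xx n [] []
  have h3 := runs_swapYZ (addRes acc xx) xx n [] [] []
  have h4 := runs_sub (addRes acc xx) n xx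
  have h5 : Runs (clear .g) (file (modAddRaw acc xx n) n xx [] [] [] [] (flag !subBorrow (addRes acc xx) n))
      (file (modAddRaw acc xx n) n xx [] [] [] [] []) 3 :=
    (runs_clear AReg.g _).of_eq (by simp) (by cases subBorrow (addRes acc xx) n <;> simp)
  have h6 := runs_normalize (modAddRaw acc xx n) n xx [] [] []
  have hl := length_addRes_le acc xx
  refine (h1.seq (h2.seq (h3.seq (h4.seq (h5.seq h6))))).of_eq rfl ?_
  rw [length_modAddRaw]
  omega


/-! ### One step of modular multiplication -/

/-- One Horner step of modular multiplication on the multiplier bit `b`: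
`x := (2x + b·z) mod y`. [Knuth 1998, §4.3.1 with §4.6.3 (binary method)] [folklore] -/
def modMulStep (b : Bool) : Com AReg := bif b then modDbl ;; modAddZ else modDbl

/-- Model of `modMulStep`. [folklore] -/
def modMulStepRes (b : Bool) (acc n xx : List Bool) : List Bool :=
  bif b then modAddRes (modDblRes acc n) xx n else modDblRes acc n

/-- **Value of a Horner step.** [folklore] -/
theorem bitsToNat_modMulStepRes (b : Bool) (acc n xx : List Bool) (h : bitsToNat acc < bitsToNat n)
    (hx : bitsToNat xx < bitsToNat n) :
    bitsToNat (modMulStepRes b acc n xx) =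
      (2 * bitsToNat acc + b.toNat * bitsToNat xx) % bitsToNat n := by
  cases b
  · simp [modMulStepRes, bitsToNat_modDblRes acc n h]
  · rw [modMulStepRes, cond_true, bitsToNat_modAddRes _ _ _ (bitsToNat_modDblRes_lt acc n h) hx,
      bitsToNat_modDblRes acc n h, Bool.toNat_true, one_mul, Nat.mod_add_mod]

/-- A Horner step is reduced. [folklore] -/
theorem bitsToNat_modMulStepRes_lt (b : Bool) (acc n xx : List Bool)
    (h : bitsToNat acc < bitsToNat n) (hx : bitsToNat xx < bitsToNat n) :
    bitsToNat (modMulStepRes b acc n xx) < bitsToNat n := by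
  rw [bitsToNat_modMulStepRes b acc n xx h hx]; exact Nat.mod_lt _ (by omega)

/-- A Horner step is not longer than the modulus. [folklore] -/
theorem length_modMulStepRes_le (b : Bool) (acc n xx : List Bool)
    (h : bitsToNat acc < bitsToNat n) (hx : bitsToNat xx < bitsToNat n) :
    (modMulStepRes b acc n xx).length ≤ n.length := by
  cases b
  · exact length_modDblRes_le acc n h
  · exact length_modAddRes_le _ _ _ (bitsToNat_modDblRes_lt acc n h) hx

/-- **Simulation of a Horner step**, in `25|x| + 116|y| + 50|z| + 111` steps. [folklore] -/
theorem runs_modMulStep (b : Bool) (acc n xx : List Bool) (h : bitsToNat acc < bitsToNat n) :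
    Runs (modMulStep b) (file acc n xx [] [] [] [] [])
      (file (modMulStepRes b acc n xx) n xx [] [] [] [] [])
      (25 * acc.length + 116 * n.length + 50 * xx.length + 111) := by
  have h1 := runs_modDbl acc n xx
  cases b
  · exact h1.of_eq rfl (by omega)
  · have h2 := runs_modAddZ (modDblRes acc n) n xx
    have hl := length_modDblRes_le acc n h
    refine (h1.seq h2).of_eq rfl ?_
    nlinarith [hl]

/-! ### Modular multiplication, the multiplier in an outer register -/

section Embedded

variable {κ : Type} [DecidableEq κ]

/-- A bank program inside a larger register file `κ ⊕ AReg`. [folklore] -/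
abbrev bk (c : Com AReg) : Com (κ ⊕ AReg) := c.map Sum.inr

/-- `modMul m`: **modular multiplication by Horner's rule**: for the bits of the outer register
`m` (the multiplier, *most significant bit first*, consumed): `x := (2x + bit·z) mod y`; from
`x = 0` this leaves `x = z · m mod y`. [Knuth 1998, §4.3.1; §4.6.3] [folklore] -/
def modMul (m : κ) : Com (κ ⊕ AReg) :=
  loop (Sum.inl m) (bk (modMulStep true)) (bk (modMulStep false))

/-- Model of `modMul`. [folklore] -/
def modMulRes : List Bool → List Bool → List Bool → List Bool → List Bool
  | [], acc, _, _ => acc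
  | b :: bs, acc, n, xx => modMulRes bs (modMulStepRes b acc n xx) n xx

/-- The model is reduced and short. [folklore] -/
theorem modMulRes_lt_and_length : ∀ (bs acc n xx : List Bool), bitsToNat acc < bitsToNat n →
    bitsToNat xx < bitsToNat n → acc.length ≤ n.length →
      bitsToNat (modMulRes bs acc n xx) < bitsToNat n ∧ (modMulRes bs acc n xx).length ≤ n.length
  | [], _, _, _, h, _, hl => ⟨h, hl⟩
  | b :: bs, acc, n, xx, h, hx, _ =>
    modMulRes_lt_and_length bs _ n xx (bitsToNat_modMulStepRes_lt b acc n xx h hx) hx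
      (length_modMulStepRes_le b acc n xx h hx)

/-- Reducing a factor first does not change a residue. [folklore] -/
private theorem mod_mul_add_mod (m P c n : ℕ) : (m % n * P + c) % n = (m * P + c) % n := by
  rw [Nat.add_mod, Nat.mod_mul_mod, ← Nat.add_mod]

/-- **Value of `modMul`** (Horner's rule, the multiplier read most significant bit first).
[Knuth 1998, §4.6.3] [folklore] -/
theorem bitsToNat_modMulRes : ∀ (bs acc n xx : List Bool), bitsToNat acc < bitsToNat n →
    bitsToNat xx < bitsToNat n →
      bitsToNat (modMulRes bs acc n xx) =
        (bitsToNat acc * 2 ^ bs.length + bitsToNat xx * bitsToNat bs.reverse) % bitsToNat n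
  | [], acc, n, xx, h, _ => by simp [-Sum.elim_update_left, -Sum.elim_update_right, modMulRes, Nat.mod_eq_of_lt h]
  | b :: bs, acc, n, xx, h, hx => by
    rw [modMulRes, bitsToNat_modMulRes bs _ n xx (bitsToNat_modMulStepRes_lt b acc n xx h hx) hx,
      bitsToNat_modMulStepRes b acc n xx h hx, List.reverse_cons, bitsToNat_append,
      List.length_reverse, List.length_cons, bitsToNat_cons, bitsToNat_nil, pow_succ]
    simp only [mul_zero, add_zero]
    rw [mod_mul_add_mod]
    congr 1; ring

/-- **Simulation of `modMul`**: with `T m = bs`, `x = acc < y = n`, `z = xx < n`, `|acc| ≤ |n|`,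
the loop empties `m` and leaves `modMulRes bs acc n xx` in `x`, in
`|bs| · (141|n| + 50|xx| + 113) + 1` steps. [folklore] -/
theorem runs_modMul (m : κ) : ∀ (bs : List Bool) (T : Regs κ) (acc n xx : List Bool),
    T m = bs → bitsToNat acc < bitsToNat n → bitsToNat xx < bitsToNat n → acc.length ≤ n.length →
      Runs (modMul m) (Sum.elim T (file acc n xx [] [] [] [] []))
        (Sum.elim (Function.update T m []) (file (modMulRes bs acc n xx) n xx [] [] [] [] []))
        (bs.length * (141 * n.length + 50 * xx.length + 113) + 1)
  | [], T, acc, n, xx, hT, _, _, _ => by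
    refine (Runs.loop_nil _ _ (by simp [-Sum.elim_update_left, -Sum.elim_update_right, hT])).of_eq ?_ (by simp [-Sum.elim_update_left, -Sum.elim_update_right])
    rw [modMulRes, ← hT, Function.update_eq_self]
  | b :: bs, T, acc, n, xx, hT, h, hx, hl => by
    have hk : (Sum.elim T (file acc n xx [] [] [] [] []) : Regs (κ ⊕ AReg)) (Sum.inl m) = b :: bs := by
      simp [hT]
    have hbody : ∀ b' : Bool, Runs (bk (modMulStep b') : Com (κ ⊕ AReg))
        (Function.update (Sum.elim T (file acc n xx [] [] [] [] [])) (Sum.inl m) bs)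
        (Sum.elim (Function.update T m bs) (file (modMulStepRes b' acc n xx) n xx [] [] [] [] []))
        (141 * n.length + 50 * xx.length + 111) := fun b' => by
      rw [Sum.update_elim_inl]
      exact ((runs_modMulStep b' acc n xx h).inr _).of_eq rfl (by nlinarith [hl])
    have hrest := runs_modMul m bs (Function.update T m bs) (modMulStepRes b acc n xx) n xx
      (by simp [-Sum.elim_update_left, -Sum.elim_update_right]) (bitsToNat_modMulStepRes_lt b acc n xx h hx) hx (length_modMulStepRes_le b acc n xx h hx)
    rw [Function.update_idem] at hrest
    cases b
    · exact (Runs.loop_false hk (hbody false) hrest).of_eq rfl (by simp [-Sum.elim_update_left, -Sum.elim_update_right]; ring_nf; omega)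
    · exact (Runs.loop_true hk (hbody true) hrest).of_eq rfl (by simp [-Sum.elim_update_left, -Sum.elim_update_right]; ring_nf; omega)


/-! ### Modular exponentiation by repeated squaring, exponent and base in outer registers -/

/-- Squaring preparation: `z := x`, outer `m := reverse x` (the multiplier, most significant
bit first), `x := 0`. [folklore] -/
def sqPrep (m : κ) : Com (κ ⊕ AReg) :=
  bk (clear .z) ;; bk (pour .x .s) ;; copy (Sum.inr .s) (Sum.inl m) (Sum.inr .t) (Sum.inr .u) ;;
    bk (pour .s .z)

/-- **Simulation of `sqPrep`.** [folklore] -/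
theorem runs_sqPrep (m : κ) (T : Regs κ) (hm : T m = []) (r n zj : List Bool) :
    Runs (sqPrep m) (Sum.elim T (file r n zj [] [] [] [] []))
      (Sum.elim (Function.update T m r.reverse) (file [] n r [] [] [] [] []))
      (2 * zj.length + 16 * r.length + 6) := by
  have h1 : Runs (bk (clear .z) : Com (κ ⊕ AReg)) (Sum.elim T (file r n zj [] [] [] [] []))
      (Sum.elim T (file r n [] [] [] [] [] [])) (2 * zj.length + 1) :=
    ((runs_clear AReg.z (file r n zj [] [] [] [] [])).inr T).of_eq (by simp [-Sum.elim_update_left, -Sum.elim_update_right]) (by simp [-Sum.elim_update_left, -Sum.elim_update_right])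
  have h2 : Runs (bk (pour .x .s) : Com (κ ⊕ AReg)) (Sum.elim T (file r n [] [] [] [] [] []))
      (Sum.elim T (file [] n [] r.reverse [] [] [] [])) (3 * r.length + 1) :=
    ((runs_pour (a := AReg.x) (b := AReg.s) (by decide) (file r n [] [] [] [] [] [])).inr T).of_eq
      (by simp [-Sum.elim_update_left, -Sum.elim_update_right]) (by simp [-Sum.elim_update_left, -Sum.elim_update_right])
  have h3 : Runs (copy (Sum.inr AReg.s) (Sum.inl m) (Sum.inr AReg.t) (Sum.inr AReg.u) : Com (κ ⊕ AReg))
      (Sum.elim T (file [] n [] r.reverse [] [] [] []))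
      (Sum.elim (Function.update T m r.reverse) (file [] n [] r.reverse [] [] [] [])) (10 * r.length + 3) :=
    (runs_copy (by simp [-Sum.elim_update_left, -Sum.elim_update_right]) (by simp [-Sum.elim_update_left, -Sum.elim_update_right]) (by simp [-Sum.elim_update_left, -Sum.elim_update_right]) (by simp [-Sum.elim_update_left, -Sum.elim_update_right]) (by simp [-Sum.elim_update_left, -Sum.elim_update_right]) (by simp [-Sum.elim_update_left, -Sum.elim_update_right]) _ (by simp [-Sum.elim_update_left, -Sum.elim_update_right]) (by simp [-Sum.elim_update_left, -Sum.elim_update_right])).of_eq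
      (by simp [-Sum.elim_update_left, -Sum.elim_update_right, hm]) (by simp [-Sum.elim_update_left, -Sum.elim_update_right])
  have h4 : Runs (bk (pour .s .z) : Com (κ ⊕ AReg))
      (Sum.elim (Function.update T m r.reverse) (file [] n [] r.reverse [] [] [] []))
      (Sum.elim (Function.update T m r.reverse) (file [] n r [] [] [] [] [])) (3 * r.length + 1) :=
    ((runs_pour (a := AReg.s) (b := AReg.z) (by decide) (file [] n [] r.reverse [] [] [] [])).inr _).of_eq
      (by simp [-Sum.elim_update_left, -Sum.elim_update_right]) (by simp [-Sum.elim_update_left, -Sum.elim_update_right])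
  exact (h1.seq (h2.seq (h3.seq h4))).of_eq rfl (by omega)

/-- Multiplication preparation: `z := ` the outer base `xb`, outer `m := reverse x`, `x := 0`.
[folklore] -/
def mulPrep (m xb : κ) : Com (κ ⊕ AReg) :=
  bk (clear .z) ;; pour (Sum.inr .x) (Sum.inl m) ;; copy (Sum.inl xb) (Sum.inr .z) (Sum.inr .t) (Sum.inr .u)

/-- **Simulation of `mulPrep`.** [folklore] -/
theorem runs_mulPrep {m xb : κ} (hmx : m ≠ xb) (T : Regs κ) (hm : T m = []) (r n zj : List Bool) :
    Runs (mulPrep m xb) (Sum.elim T (file r n zj [] [] [] [] []))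
      (Sum.elim (Function.update T m r.reverse) (file [] n (T xb) [] [] [] [] []))
      (2 * zj.length + 3 * r.length + 10 * (T xb).length + 5) := by
  have h1 : Runs (bk (clear .z) : Com (κ ⊕ AReg)) (Sum.elim T (file r n zj [] [] [] [] []))
      (Sum.elim T (file r n [] [] [] [] [] [])) (2 * zj.length + 1) :=
    ((runs_clear AReg.z (file r n zj [] [] [] [] [])).inr T).of_eq (by simp [-Sum.elim_update_left, -Sum.elim_update_right]) (by simp [-Sum.elim_update_left, -Sum.elim_update_right])
  have h2 : Runs (pour (Sum.inr AReg.x) (Sum.inl m) : Com (κ ⊕ AReg)) (Sum.elim T (file r n [] [] [] [] [] []))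
      (Sum.elim (Function.update T m r.reverse) (file [] n [] [] [] [] [] [])) (3 * r.length + 1) :=
    (runs_pour (by simp [-Sum.elim_update_left, -Sum.elim_update_right]) _).of_eq (by simp [-Sum.elim_update_left, -Sum.elim_update_right, hm]) (by simp [-Sum.elim_update_left, -Sum.elim_update_right])
  have h3 : Runs (copy (Sum.inl xb) (Sum.inr AReg.z) (Sum.inr AReg.t) (Sum.inr AReg.u) : Com (κ ⊕ AReg))
      (Sum.elim (Function.update T m r.reverse) (file [] n [] [] [] [] [] []))
      (Sum.elim (Function.update T m r.reverse) (file [] n (T xb) [] [] [] [] [])) (10 * (T xb).length + 3) :=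
    (runs_copy (by simp [-Sum.elim_update_left, -Sum.elim_update_right]) (by simp [-Sum.elim_update_left, -Sum.elim_update_right]) (by simp [-Sum.elim_update_left, -Sum.elim_update_right]) (by simp [-Sum.elim_update_left, -Sum.elim_update_right]) (by simp [-Sum.elim_update_left, -Sum.elim_update_right]) (by simp [-Sum.elim_update_left, -Sum.elim_update_right]) _ (by simp [-Sum.elim_update_left, -Sum.elim_update_right]) (by simp [-Sum.elim_update_left, -Sum.elim_update_right])).of_eq
      (by simp [-Sum.elim_update_left, -Sum.elim_update_right, hmx.symm]) (by simp [-Sum.elim_update_left, -Sum.elim_update_right, hmx.symm])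
  exact (h1.seq (h2.seq h3)).of_eq rfl (by omega)

/-- Model of a modular squaring `x := x² mod y` (`sqPrep` then `modMul`). [folklore] -/
def modSqRes (r n : List Bool) : List Bool := modMulRes r.reverse [] n r

/-- Model of one square-and-multiply step. [folklore] -/
def modExpStepRes (b : Bool) (r n xb : List Bool) : List Bool :=
  bif b then modMulRes (modSqRes r n).reverse [] n xb else modSqRes r n

/-- Model of `modExp`. [folklore] -/
def modExpRes : List Bool → List Bool → List Bool → List Bool → List Bool
  | [], r, _, _ => r
  | b :: bs, r, n, xb => modExpRes bs (modExpStepRes b r n xb) n xb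

/-- Value and size of a modular squaring. [folklore] -/
theorem modSqRes_spec (r n : List Bool) (h : bitsToNat r < bitsToNat n) :
    bitsToNat (modSqRes r n) = (bitsToNat r * bitsToNat r) % bitsToNat n ∧
      bitsToNat (modSqRes r n) < bitsToNat n ∧ (modSqRes r n).length ≤ n.length := by
  have h0 : bitsToNat ([] : List Bool) < bitsToNat n := by simp; omega
  refine ⟨?_, modMulRes_lt_and_length _ _ _ _ h0 h (by simp [-Sum.elim_update_left, -Sum.elim_update_right])⟩
  rw [modSqRes, bitsToNat_modMulRes _ _ _ _ h0 h, List.reverse_reverse]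
  simp

/-- Value and size of a square-and-multiply step. [folklore] -/
theorem modExpStepRes_spec (b : Bool) (r n xb : List Bool) (h : bitsToNat r < bitsToNat n)
    (hx : bitsToNat xb < bitsToNat n) :
    bitsToNat (modExpStepRes b r n xb) =
        (bitsToNat r * bitsToNat r * bitsToNat xb ^ b.toNat) % bitsToNat n ∧
      bitsToNat (modExpStepRes b r n xb) < bitsToNat n ∧ (modExpStepRes b r n xb).length ≤ n.length := by
  obtain ⟨hv, hlt, hlen⟩ := modSqRes_spec r n h
  have h0 : bitsToNat ([] : List Bool) < bitsToNat n := by simp; omega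
  cases b
  · simpa [modExpStepRes] using And.intro hv (And.intro hlt hlen)
  · refine ⟨?_, modMulRes_lt_and_length _ _ _ _ h0 hx (by simp [-Sum.elim_update_left, -Sum.elim_update_right])⟩
    rw [modExpStepRes, cond_true, bitsToNat_modMulRes _ _ _ _ h0 hx, List.reverse_reverse, hv]
    simp only [bitsToNat_nil, zero_mul, zero_add, Bool.toNat_true, pow_one]
    rw [Nat.mul_mod, Nat.mod_mod, ← Nat.mul_mod, mul_comm]

/-- The model of `modExp` is reduced and short. [folklore] -/
theorem modExpRes_lt_and_length : ∀ (bs r n xb : List Bool), bitsToNat r < bitsToNat n →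
    bitsToNat xb < bitsToNat n → r.length ≤ n.length →
      bitsToNat (modExpRes bs r n xb) < bitsToNat n ∧ (modExpRes bs r n xb).length ≤ n.length
  | [], _, _, _, h, _, hl => ⟨h, hl⟩
  | b :: bs, r, n, xb, h, hx, _ =>
    modExpRes_lt_and_length bs _ n xb (modExpStepRes_spec b r n xb h hx).2.1 hx
      (modExpStepRes_spec b r n xb h hx).2.2

/-- **Value of `modExp`** (the loop invariant `d = a^c mod n` of MODULAR-EXPONENTIATION, the
exponent read most significant bit first). [cite: CLRS2009, §31.6 (MODULAR-EXPONENTIATION, loop invariant)] -/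
theorem bitsToNat_modExpRes : ∀ (bs r n xb : List Bool), bitsToNat r < bitsToNat n →
    bitsToNat xb < bitsToNat n →
      bitsToNat (modExpRes bs r n xb) =
        (bitsToNat r ^ 2 ^ bs.length * bitsToNat xb ^ bitsToNat bs.reverse) % bitsToNat n
  | [], r, n, xb, h, _ => by simp [-Sum.elim_update_left, -Sum.elim_update_right, modExpRes, Nat.mod_eq_of_lt h]
  | b :: bs, r, n, xb, h, hx => by
    obtain ⟨hv, hlt, -⟩ := modExpStepRes_spec b r n xb h hx
    rw [modExpRes, bitsToNat_modExpRes bs _ n xb hlt hx, List.reverse_cons, bitsToNat_append,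
      List.length_reverse, List.length_cons, bitsToNat_cons, bitsToNat_nil, pow_succ, Nat.mul_mod, hv,
      Nat.pow_mod, Nat.mod_mod, ← Nat.pow_mod, ← Nat.mul_mod]
    simp only [mul_zero, add_zero]
    congr 1
    rw [pow_add, pow_mul, pow_mul, mul_pow, mul_pow, ← pow_mul (bitsToNat xb) b.toNat, mul_comm b.toNat]
    ring

/-- One square-and-multiply step on the exponent bit `b`. [folklore] -/
def modExpBody (xb m : κ) (b : Bool) : Com (κ ⊕ AReg) :=
  sqPrep m ;; modMul m ;; bif b then mulPrep m xb ;; modMul m else skip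

/-- `modExp e xb m`: **modular exponentiation by repeated squaring**: for the bits of the outer
register `e` (the exponent, most significant bit first, consumed): square `x` modulo `y`, and
multiply by the outer base `xb` modulo `y` if the bit is set (`m`: multiplier scratch). From
`x = 1` this leaves `x = xb ^ e mod y` (CLRS's MODULAR-EXPONENTIATION, the squaring done by
`sqPrep ; modMul`, the multiplication by `mulPrep ; modMul`).
[cite: CLRS2009, §31.6 (MODULAR-EXPONENTIATION)] -/
def modExp (e xb m : κ) : Com (κ ⊕ AReg) :=
  loop (Sum.inl e) (modExpBody xb m true) (modExpBody xb m false)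

/-- Cost of one square-and-multiply step in terms of the modulus length `L`. [folklore] -/
def modExpStepCost (L : ℕ) : ℕ := 382 * L ^ 2 + 262 * L + 13

/-- **Simulation of one square-and-multiply step.** [folklore] -/
theorem runs_modExpBody {xb m : κ} (hmx : m ≠ xb) (b : Bool) (T : Regs κ)
    (hm : T m = []) (r n zj : List Bool) (h : bitsToNat r < bitsToNat n)
    (hx : bitsToNat (T xb) < bitsToNat n) (hrl : r.length ≤ n.length) (hzl : zj.length ≤ n.length)
    (hxl : (T xb).length ≤ n.length) :
    ∃ zj' : List Bool, zj'.length ≤ n.length ∧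
      Runs (modExpBody xb m b) (Sum.elim T (file r n zj [] [] [] [] []))
        (Sum.elim T (file (modExpStepRes b r n (T xb)) n zj' [] [] [] [] [])) (modExpStepCost n.length) := by
  have h0 : bitsToNat ([] : List Bool) < bitsToNat n := by simp; omega
  have h1 := runs_sqPrep m T hm r n zj
  have hTm : Function.update T m [] = T := Function.update_eq_self_iff.2 hm.symm
  have h2 := runs_modMul m r.reverse (Function.update T m r.reverse) [] n r (by simp) h0 h (by simp)
  rw [Function.update_idem, hTm] at h2
  obtain ⟨hsv, hslt, hslen⟩ := modSqRes_spec r n h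
  rw [List.length_reverse] at h2
  change Runs _ _ (Sum.elim T (file (modSqRes r n) n r [] [] [] [] [])) _ at h2
  cases b
  · refine ⟨r, hrl, ((h1.seq (h2.seq (Runs.skip _))).of_eq rfl ?_)⟩
    rw [modExpStepCost]; nlinarith [hrl, hzl]
  · have h3 := runs_mulPrep hmx T hm (modSqRes r n) n r
    have h4 := runs_modMul m (modSqRes r n).reverse (Function.update T m (modSqRes r n).reverse) [] n (T xb)
      (by simp) h0 hx (by simp)
    rw [Function.update_idem, hTm, List.length_reverse] at h4
    refine ⟨T xb, hxl, ((h1.seq (h2.seq (h3.seq h4))).of_eq rfl ?_)⟩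
    rw [modExpStepCost]
    nlinarith [hrl, hzl, hxl, hslen]

/-- **Simulation of `modExp`**: with `T e = bs` (exponent bits, most significant first),
`T m = []`, base `T xb < y = n`, `x = r < n`, all operands at most as long as the modulus, the
loop empties `e` and leaves `modExpRes bs r n (T xb)` in `x` (and junk of length `≤ |n|` in `z`),
in `|bs| · (modExpStepCost |n| + 2) + 1` steps (CLRS: `O(β)` arithmetic operations,
`O(β³)` bit operations). [cite: CLRS2009, §31.6 (MODULAR-EXPONENTIATION, running time)] -/
theorem runs_modExp {e xb m : κ} (hmx : m ≠ xb) (hme : m ≠ e) (hex : e ≠ xb) :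
    ∀ (bs : List Bool) (T : Regs κ) (r n zj : List Bool), T e = bs → T m = [] →
      bitsToNat r < bitsToNat n → bitsToNat (T xb) < bitsToNat n → r.length ≤ n.length →
      zj.length ≤ n.length → (T xb).length ≤ n.length →
      ∃ zj' : List Bool, zj'.length ≤ n.length ∧
        Runs (modExp e xb m) (Sum.elim T (file r n zj [] [] [] [] []))
          (Sum.elim (Function.update T e []) (file (modExpRes bs r n (T xb)) n zj' [] [] [] [] []))
          (bs.length * (modExpStepCost n.length + 2) + 1)
  | [], T, r, n, zj, hT, _, _, _, _, hzl, _ => by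
    refine ⟨zj, hzl, (Runs.loop_nil _ _ (by simp [-Sum.elim_update_left, -Sum.elim_update_right, hT])).of_eq ?_ (by simp [-Sum.elim_update_left, -Sum.elim_update_right])⟩
    rw [modExpRes, ← hT, Function.update_eq_self]
  | b :: bs, T, r, n, zj, hT, hm, h, hx, hrl, hzl, hxl => by
    have hk : (Sum.elim T (file r n zj [] [] [] [] []) : Regs (κ ⊕ AReg)) (Sum.inl e) = b :: bs := by
      simp [hT]
    obtain ⟨zj₁, hz₁, hbody⟩ := runs_modExpBody hmx b (Function.update T e bs) (by simp [-Sum.elim_update_left, -Sum.elim_update_right, hme, hm]) r n zj h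
      (by simp [-Sum.elim_update_left, -Sum.elim_update_right, hex.symm, hx]) hrl hzl (by simp [-Sum.elim_update_left, -Sum.elim_update_right, hex.symm, hxl])
    rw [← Sum.update_elim_inl] at hbody
    simp only [Function.update_of_ne hex.symm] at hbody
    obtain ⟨hslt, hslen⟩ := (modExpStepRes_spec b r n (T xb) h hx).2
    obtain ⟨zj₂, hz₂, hrest⟩ := runs_modExp hmx hme hex bs (Function.update T e bs) _ n zj₁ (by simp [-Sum.elim_update_left, -Sum.elim_update_right])
      (by simp [-Sum.elim_update_left, -Sum.elim_update_right, hme, hm]) hslt (by simp [-Sum.elim_update_left, -Sum.elim_update_right, hex.symm, hx]) hslen hz₁ (by simp [-Sum.elim_update_left, -Sum.elim_update_right, hex.symm, hxl])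
    simp only [Function.update_of_ne hex.symm, Function.update_idem] at hrest
    refine ⟨zj₂, hz₂, ?_⟩
    cases b
    · exact (Runs.loop_false hk hbody hrest).of_eq rfl (by simp [-Sum.elim_update_left, -Sum.elim_update_right]; ring_nf; omega)
    · exact (Runs.loop_true hk hbody hrest).of_eq rfl (by simp [-Sum.elim_update_left, -Sum.elim_update_right]; ring_nf; omega)


/-- **`modMul` from zero computes the product** `z · m mod y` (the multiplier value is
`bitsToNat bs.reverse` as the bits are read most significant first). [folklore] -/
theorem bitsToNat_modMulRes_nil (bs n xx : List Bool) (hn : 0 < bitsToNat n)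
    (hx : bitsToNat xx < bitsToNat n) :
    bitsToNat (modMulRes bs [] n xx) = (bitsToNat xx * bitsToNat bs.reverse) % bitsToNat n := by
  rw [bitsToNat_modMulRes bs [] n xx (by simpa using hn) hx]; simp

/-- **`modExp` from one computes the power** `xb ^ e mod y`. [cite: CLRS2009, §31.6 (MODULAR-EXPONENTIATION, termination)] -/
theorem bitsToNat_modExpRes_one (bs n xb : List Bool) (hn : 1 < bitsToNat n)
    (hx : bitsToNat xb < bitsToNat n) :
    bitsToNat (modExpRes bs [true] n xb) = bitsToNat xb ^ bitsToNat bs.reverse % bitsToNat n := by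
  rw [bitsToNat_modExpRes bs [true] n xb (by simpa using hn) hx]; simp

end Embedded

end Com
end Literature.Computability.Complexity
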